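import Literature.Computability.QuantumComplexity.CWrapLayout
import Literature.Computability.QuantumComplexity.UncomputeBranches
import Literature.Computability.QuantumComplexity.SandwichCircuit
import HarnessLib

/-!
# A garbage-free classical computation placed on scattered data wires of a quantum register

Topic `Literature/Computability/QuantumComplexity`. `RevUncompute.lean` builds Bennett's garbage-free
block `RevClean.cleanOps e M n₀ v` over `ℕ`-indexed wires — data on `0 … n₀−1`, work wires from
`n₀` on, result wires holding the read-out code of the output word — and proves its semantics on the
assignment `strW d` (`RevClean.clEval_cleanOps`). Inside a quantum algorithm the data sit on given
wires `dpos 0, …, dpos (n₀−1)` of an `N`-wire register (a prefix of a point register in the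
Grover–Rudolph stage of Regev's sampler, Lemma 3.12/3.14) and the work area is a window `[base, top)`
above all data. This file places the block accordingly and lifts its semantics to basis states:

* `CleanPlaced.relabel n₀ dpos base` — the injective re-indexing `i < n₀ ↦ dpos i`, `i ≥ n₀ ↦ base + (i − n₀)`
  (`relabel_injective`); `CleanPlaced.placedOps` — `cleanOps` re-indexed and brought to `Fin N`
  (`placedOps_wf`, wire facts `mem_wires_placedOps`);
* **`CleanPlaced.clEval_placedOps`** — on a label `z` carrying the data word `d` on the data wires and
  clean on the work window, the placed block leaves every wire outside the work window unchanged and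
  writes `readOut (M's output on d ++ v)` on the work window (so the result wire of cell `j`, code
  `symTrue`, holds bit `j` of the output word: `CWrap.outBit_symTrue_eq`);
* `CleanPlaced.circuit` — its exact Clifford+`T` compilation (`revCompile ∘ toRevList`) with
  **`CleanPlaced.isBasisMap_circuit`**: `IsBasisMap (circuit.toMatrix) (clEval placedOps)`, unitary, and
  the reverse program undoing it (`clEval_reverse_placedOps`).

Everything here is proved; definitions have bodies; no named fact is introduced.

## References

* C. H. Bennett, IBM J. Res. Develop. 17 (1973), §2 (compute–copy–uncompute); restated and proved in the
  tree as `RevClean.clEval_cleanOps` [cite: Shor1997, §3 p.8].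
* O. Regev, J. ACM 56 (2009), art. 34, Lemma 3.12 (proof: "a classical algorithm … this completes the
  description"), Lemma 3.14 [Regev2009].
* M. A. Nielsen, I. L. Chuang, *Quantum Computation and Quantum Information*, CUP 2010, §3.2.5 [NielsenChuang2010].
-/

noncomputable section

namespace Literature.Computability.QuantumComplexity

namespace CleanPlaced

open Complexity Complexity.FinTM2Sim Turing Function RevSim RevClean Cryptography

variable {N : ℕ}

/-! ### The re-indexing -/

/-- **The re-indexing**: data wire `i < n₀` to `dpos i`, work wire `i ≥ n₀` to `base + (i − n₀)`. [folklore] -/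
def relabel (n₀ : ℕ) (dpos : ℕ → ℕ) (base : ℕ) (i : ℕ) : ℕ := if i < n₀ then dpos i else base + (i - n₀)

/-- The re-indexing is injective when the data positions are injective below `n₀` and below `base`. [folklore] -/
theorem relabel_injective {n₀ : ℕ} {dpos : ℕ → ℕ} {base : ℕ} (hinj : ∀ i j, i < n₀ → j < n₀ → dpos i = dpos j → i = j)
    (hlt : ∀ i, i < n₀ → dpos i < base) : Injective (relabel n₀ dpos base) := by
  intro i j h
  unfold relabel at h
  by_cases hi : i < n₀ <;> by_cases hj : j < n₀
  · rw [if_pos hi, if_pos hj] at h; exact hinj i j hi hj h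
  · rw [if_pos hi, if_neg hj] at h; have := hlt i hi; omega
  · rw [if_neg hi, if_pos hj] at h; have := hlt j hj; omega
  · rw [if_neg hi, if_neg hj] at h; omega

/-- Values of the re-indexing on data wires. [folklore] -/
theorem relabel_of_lt {n₀ : ℕ} (dpos : ℕ → ℕ) (base : ℕ) {i : ℕ} (hi : i < n₀) : relabel n₀ dpos base i = dpos i := if_pos hi

/-- Values of the re-indexing on work wires. [folklore] -/
theorem relabel_of_le {n₀ : ℕ} (dpos : ℕ → ℕ) (base : ℕ) {i : ℕ} (hi : n₀ ≤ i) : relabel n₀ dpos base i = base + (i - n₀) :=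
  if_neg (Nat.not_lt.2 hi)

/-! ### The placed block -/

section Placed

variable (hN : 0 < N) (e : ℕ) (M : TM2ComputableAux Bool Bool) (n₀ : ℕ) (v : List Bool) (dpos : ℕ → ℕ) (base : ℕ)

/-- **The placed clean block**: `cleanOps` re-indexed by `relabel` and brought to `Fin N`. [cite: Shor1997, §3 p.8] -/
def placedOps : List (ClOp (Fin N)) :=
  ((cleanOps e M n₀ v).map (ClOp.map (relabel n₀ dpos base))).map (ClOp.map (finOf N hN))

/-- The top of the work window: `base + (width − n₀)`. [folklore] -/
def top : ℕ := base + (width e M (n₀ + v.length) - n₀)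

variable {hN e M n₀ v dpos base}

/-- **Geometry hypotheses** of a placement. [folklore] -/
structure GeomOK (N : ℕ) (e : ℕ) (M : TM2ComputableAux Bool Bool) (n₀ : ℕ) (v : List Bool) (dpos : ℕ → ℕ) (base : ℕ) : Prop where
  /-- data positions injective -/
  inj : ∀ i j, i < n₀ → j < n₀ → dpos i = dpos j → i = j
  /-- data below the work window -/
  lt : ∀ i, i < n₀ → dpos i < base
  /-- the work window fits -/
  top_le : top e M n₀ v base ≤ N

variable (G : GeomOK N e M n₀ v dpos base)
include G

/-- Wires of the re-indexed block are below `N`. [folklore] -/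
theorem lt_of_mem_wiresOf_map : ∀ op ∈ (cleanOps e M n₀ v).map (ClOp.map (relabel n₀ dpos base)), ∀ i ∈ wiresOf op, i < N := by
  intro op hop i hi
  rw [List.mem_map] at hop
  obtain ⟨op₀, hop₀, rfl⟩ := hop
  have hw : ∃ i₀ ∈ wiresOf op₀, i = relabel n₀ dpos base i₀ := by
    rw [mem_wiresOf] at hi
    rcases hi with rfl | hi
    · exact ⟨op₀.target, (mem_wiresOf _ _).2 (Or.inl rfl), ClOp.target_map _ _⟩
    · rw [ClOp.controls_map, List.mem_map] at hi
      obtain ⟨c, hc, rfl⟩ := hi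
      exact ⟨c, (mem_wiresOf _ _).2 (Or.inr hc), rfl⟩
  obtain ⟨i₀, hi₀, rfl⟩ := hw
  have hlt := cleanOps_lt (e := e) (M := M) op₀ hop₀ i₀ hi₀
  have htop := G.top_le
  unfold top at htop
  unfold relabel
  split_ifs with h
  · exact (G.lt i₀ h).trans_le (by omega)
  · omega

/-- **The placed block is well formed.** [folklore] -/
theorem placedOps_wf : ∀ op ∈ placedOps hN e M n₀ v dpos base, op.WF := by
  intro op hop
  unfold placedOps at hop
  rw [List.mem_map] at hop
  obtain ⟨op₁, hop₁, rfl⟩ := hop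
  refine wf_map_finOf hN (lt_of_mem_wiresOf_map G op₁ hop₁) ?_
  rw [List.mem_map] at hop₁
  obtain ⟨op₀, hop₀, rfl⟩ := hop₁
  exact (cleanOps_wf op₀ hop₀).map (relabel_injective G.inj G.lt)

/-- **Wires of the placed block** are data wires or work-window wires. [folklore] -/
theorem mem_wires_placedOps {op : ClOp (Fin N)} (hop : op ∈ placedOps hN e M n₀ v dpos base) {x : Fin N} (hx : x ∈ wiresOf op) :
    (∃ i, i < n₀ ∧ (x : ℕ) = dpos i) ∨ (base ≤ (x : ℕ) ∧ (x : ℕ) < top e M n₀ v base) := by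
  unfold placedOps at hop
  rw [List.mem_map] at hop
  obtain ⟨op₁, hop₁, rfl⟩ := hop
  have hx' : ∃ i₁ ∈ wiresOf op₁, x = finOf N hN i₁ := by
    rw [mem_wiresOf] at hx
    rcases hx with rfl | hx
    · exact ⟨op₁.target, (mem_wiresOf _ _).2 (Or.inl rfl), ClOp.target_map _ _⟩
    · rw [ClOp.controls_map, List.mem_map] at hx
      obtain ⟨c, hc, rfl⟩ := hx
      exact ⟨c, (mem_wiresOf _ _).2 (Or.inr hc), rfl⟩
  obtain ⟨i₁, hi₁, rfl⟩ := hx'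
  have hi₁N := lt_of_mem_wiresOf_map G op₁ hop₁ i₁ hi₁
  rw [val_finOf_of_lt hN hi₁N]
  rw [List.mem_map] at hop₁
  obtain ⟨op₀, hop₀, rfl⟩ := hop₁
  have hw : ∃ i₀ ∈ wiresOf op₀, i₁ = relabel n₀ dpos base i₀ := by
    rw [mem_wiresOf] at hi₁
    rcases hi₁ with rfl | hi
    · exact ⟨op₀.target, (mem_wiresOf _ _).2 (Or.inl rfl), ClOp.target_map _ _⟩
    · rw [ClOp.controls_map, List.mem_map] at hi
      obtain ⟨c, hc, rfl⟩ := hi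
      exact ⟨c, (mem_wiresOf _ _).2 (Or.inr hc), rfl⟩
  obtain ⟨i₀, hi₀, rfl⟩ := hw
  have hlt := cleanOps_lt (e := e) (M := M) op₀ hop₀ i₀ hi₀
  by_cases h : i₀ < n₀
  · exact Or.inl ⟨i₀, h, relabel_of_lt dpos base h⟩
  · right
    rw [relabel_of_le dpos base (Nat.not_lt.1 h)]
    unfold top
    omega

/-- The targets of the placed block are not a given wire off the data and the work window. [folklore] -/
theorem target_ne_of_off {t : Fin N} (ht₁ : ∀ i, i < n₀ → (t : ℕ) ≠ dpos i) (ht₂ : (t : ℕ) < base ∨ top e M n₀ v base ≤ (t : ℕ)) :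
    ∀ op ∈ placedOps hN e M n₀ v dpos base, op.target ≠ t := by
  intro op hop heq
  rcases mem_wires_placedOps G hop ((mem_wiresOf _ _).2 (Or.inl heq.symm)) with ⟨i, hi, hx⟩ | ⟨h1, h2⟩
  · exact ht₁ i hi hx
  · omega

/-! ### Semantics on labels -/

/-- **Semantics of the placed block.** Let `z` carry the word `d` (`|d| = n₀`) on the data wires and be
clean on the work window, and let `M` output `l'` on `d ++ v` within `T`. Then after the block:
wires off the work window are unchanged, and the work-window wire `base + w` holds
`readOut (n₀ + |v|) l' (n₀ + w)`. [cite: Shor1997, §3 p.8] [cite: NielsenChuang2010, §3.2.5] -/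
theorem clEval_placedOps (d l' : List Bool) (hd : d.length = n₀) (hM : M.OutputsWithin (d ++ v) l' (Tn e (d.length + v.length)))
    (z : QReg N) (hzd : ∀ i (hi : i < n₀), z (finOf N hN (dpos i)) = d.getD i false)
    (hzw : ∀ w, base + w < top e M n₀ v base → z (finOf N hN (base + w)) = false) :
    (∀ x : Fin N, ((x : ℕ) < base ∨ top e M n₀ v base ≤ (x : ℕ)) → clEval (placedOps hN e M n₀ v dpos base) z x = z x) ∧
    (∀ w, base + w < top e M n₀ v base →
      clEval (placedOps hN e M n₀ v dpos base) z (finOf N hN (base + w)) = readOut e M (n₀ + v.length) l' (n₀ + w)) := by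
  have htop := G.top_le
  set g := relabel n₀ dpos base with hg
  have hginj : Injective g := relabel_injective G.inj G.lt
  set ops₁ := (cleanOps e M n₀ v).map (ClOp.map g) with hops₁
  have hN₁ := lt_of_mem_wiresOf_map G
  -- the pulled-back assignment agrees with `strW d` on the block's wires
  have hagree : ∀ i, i < width e M (n₀ + v.length) → (liftW z ∘ g) i = strW d i := by
    intro i hi
    simp only [Function.comp_apply, strW]
    by_cases h : i < n₀
    · rw [hg, relabel_of_lt dpos base h]
      have hlt : dpos i < N := (G.lt i h).trans_le (by unfold top at htop; omega)
      rw [show liftW z (dpos i) = z (finOf N hN (dpos i)) by rw [finOf_of_lt hN hlt]; simp [liftW, hlt], hzd i h]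
    · rw [hg, relabel_of_le dpos base (Nat.not_lt.1 h)]
      have hw : base + (i - n₀) < top e M n₀ v base := by unfold top; omega
      have hlt : base + (i - n₀) < N := hw.trans_le htop
      rw [show liftW z (base + (i - n₀)) = z (finOf N hN (base + (i - n₀))) by rw [finOf_of_lt hN hlt]; simp [liftW, hlt], hzw _ hw,
        List.getD_eq_default _ _ (by rw [hd]; omega)]
  -- the block on the pulled-back assignment
  have hrun : ∀ i, i < width e M (n₀ + v.length) → clEval (cleanOps e M n₀ v) (liftW z ∘ g) i = clEval (cleanOps e M n₀ v) (strW d) i :=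
    fun i hi => clEval_agree (· < width e M (n₀ + v.length)) _ cleanOps_lt (fun i hi => hagree i hi) i hi
  have hsem : ∀ i, i < width e M (n₀ + v.length) →
      clEval (placedOps hN e M n₀ v dpos base) z (finOf N hN (g i)) = clEval (cleanOps e M n₀ v) (strW d) i := by
    intro i hi
    have hgi : g i < N := by
      by_cases h : i < n₀
      · rw [hg, relabel_of_lt dpos base h]; exact (G.lt i h).trans_le (by unfold top at htop; omega)
      · rw [hg, relabel_of_le dpos base (Nat.not_lt.1 h)]; unfold top at htop; omega
    unfold placedOps
    rw [clEval_map_finOf_apply hN ops₁ hN₁ z, val_finOf_of_lt hN hgi, hops₁, clEval_map_apply hginj, hrun i hi]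
  have hsemantics := clEval_cleanOps (e := e) (M := M) d v l' hM
  rw [hd] at hsemantics
  constructor
  · -- off the work window: either a data wire (kept) or untouched
    intro x hx
    by_cases hdata : ∃ i, i < n₀ ∧ (x : ℕ) = dpos i
    · obtain ⟨i, hi, hxi⟩ := hdata
      have hxe : x = finOf N hN (g i) := by rw [hg, relabel_of_lt dpos base hi]; exact Fin.ext (by rw [val_finOf_of_lt hN (hxi ▸ x.2), hxi])
      have hiw : i < width e M (n₀ + v.length) := by
        have := le_NN (e := e) (M := M) (n₀ + v.length); have := NN_le_width (e := e) (M := M) (n₀ + v.length); omega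
      have key := hsem i hiw
      rw [hsemantics] at key
      dsimp only at key
      rw [if_pos hi] at key
      rw [hxe, key, hg, relabel_of_lt dpos base hi, hzd i hi]
    · push Not at hdata
      refine clEval_apply_of_forall_target_ne _ _ (target_ne_of_off G (fun i hi h => hdata i hi h) hx)
  · intro w hw
    have hi : n₀ + w < width e M (n₀ + v.length) := by unfold top at hw; omega
    have hgw : g (n₀ + w) = base + w := by rw [hg, relabel_of_le dpos base (Nat.le_add_right _ _), Nat.add_sub_cancel_left]
    have key := hsem _ hi
    rw [hgw, hsemantics] at key
    dsimp only at key
    rw [if_neg (by omega)] at key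
    exact key

omit G in
/-- **Running the reversed block undoes it.** [folklore] -/
theorem clEval_reverse_placedOps (hwf : ∀ op ∈ placedOps hN e M n₀ v dpos base, op.WF) (z : QReg N) :
    clEval (placedOps hN e M n₀ v dpos base).reverse (clEval (placedOps hN e M n₀ v dpos base) z) = z :=
  clEval_reverse_clEval _ hwf z

/-! ### The circuits -/

/-- **The compiled block.** [cite: NielsenChuang2010, §3.2.5] -/
def circuit : QCircuit cliffordT N := ⟨revCompile (toRevList (placedOps hN e M n₀ v dpos base) (placedOps_wf G))⟩

/-- **The compiled reversed block.** [cite: NielsenChuang2010, §3.2.5] -/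
def circuitRev : QCircuit cliffordT N :=
  ⟨revCompile (toRevList (placedOps hN e M n₀ v dpos base).reverse (wf_reverse (placedOps_wf G)))⟩

/-- **The compiled block is the basis map of the placed program.** [folklore] -/
theorem isBasisMap_circuit : IsBasisMap ((circuit G (hN := hN)).toMatrix 0) (clEval (placedOps hN e M n₀ v dpos base)) := fun z => by
  rw [circuit, revCompile_mulVec_basisState, revEval_toRevList]

/-- The compiled reversed block is the basis map of the reversed program. [folklore] -/
theorem isBasisMap_circuitRev :
    IsBasisMap ((circuitRev G (hN := hN)).toMatrix 0) (clEval (placedOps hN e M n₀ v dpos base).reverse) := fun z => by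
  rw [circuitRev, revCompile_mulVec_basisState, revEval_toRevList]

/-- The compiled blocks are unitary. [folklore] -/
theorem circuit_mem_unitaryGroup :
    (circuit G (hN := hN)).toMatrix 0 ∈ Matrix.unitaryGroup (QReg N) ℂ ∧ (circuitRev G (hN := hN)).toMatrix 0 ∈ Matrix.unitaryGroup (QReg N) ℂ :=
  ⟨QCircuit.toMatrix_mem_unitaryGroup_holds cliffordT_isUnitary_holds 0 _, QCircuit.toMatrix_mem_unitaryGroup_holds cliffordT_isUnitary_holds 0 _⟩

end Placed

end CleanPlaced

end Literature.Computability.QuantumComplexity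

end
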